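import Literature.AlgebraicGeometry.HodgeTheory.CyclicCoverPencilChartPartial
import Literature.AlgebraicGeometry.Motives.UniversalHypersurfaceRegularLocusChartPartial
import Literature.AlgebraicGeometry.Motives.UniversalHypersurfaceRegularLocusChartSubmersion
import Literature.Geometry.ComplexAnalytic.CyclicNodePencilShellSubmersion
import HarnessLib

/-!
# The coefficient map and the Morse radius are jointly submersive on the Morse shells of the nodal pencil

Family `hodge`, layer `Literature/AlgebraicGeometry/HodgeTheory`; the ASSEMBLY of the joint-submersion hypothesis `hsurj₂` of the tangent-lift
lemma `Geometry/Manifold/SubmersionLiftVectorField.exists_contMDiff_lift_vectorField_tangent` for the degeneration `x₃^p = f₁ + c·x₂^p` to the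
one-nodal surface `x₃^p = f₁`, `f₁ = x₂^{p−2}x₀x₁ + x₀^p + x₁^p` (programme discharging `HodgeTheory/CyclicCoverNodalMeridianLocalMonodromyBound`),
from the pieces: `Motives/UniversalHypersurfaceRegularLocusChartSubmersion` (manifold differential = Euclidean differential ∘ chart differential),
`Motives/UniversalHypersurfaceRegularLocusChartPartial` (Euclidean differential onto ⇐ partial map in `y` onto), `CyclicCoverPencilChartPartial`
(the solved coefficient along the pencil is `−φ(y)`), and `Geometry/ComplexAnalytic/CyclicNodePencilShellSubmersion` (`(φ, Σ|Θ|²)` is submersive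
on the shells):

* `surjective_fderiv_neg_fst` — post-composing with `(c, t) ↦ (−c, t)` preserves surjectivity of a differential;
* `surjective_mfderiv_regCoeff_prod_morseRadius` — **at a point `Q ∈ 𝒴°(ℂ)₂` whose remaining coefficients are those of `x₃^p − f₁`, whose affine
  coordinates `y` lie in the Morse shell `r₀² ≤ Σ|Θ y|² ≤ r₂²`, `|φ y| < r₀^p`, and for any `C^∞` function `B` of the chart coordinates which agrees
  with the Morse radius `Σ|Θ(y)|²` near `Φ₂(Q)`, the differential of `Q' ↦ (b(Q'), regChartExtend B Q')` at `Q` is onto.**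

Everything is proved; no definitions, no named facts.

## References

* [Milnor1968] J. Milnor, Singular Points of Complex Hypersurfaces (1968), §4–§5 (the Milnor fibration; spheres transverse to the fibres).
* [CarlsonToledo1999] J. A. Carlson, D. Toledo, Duke Math. J. 97 (1999), §6 (kdoublept) (the local degeneration `y^k = x₁² + x₂²`).
* [BrockerJanichIDT1982] T. Bröcker, K. Jänich, Introduction to Differential Topology (1982), §5, (8.12).
-/

noncomputable section

open CategoryTheory AlgebraicGeometry MvPolynomial TopologicalSpace Set Topology Filter
open scoped Manifold ContDiff
open Literature.AlgebraicGeometry.Motives Literature.AlgebraicGeometry.Motives.UniversalHypersurface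
open Literature.AlgebraicGeometry.HodgeTheory.UniversalHypersurface Literature.Geometry.ComplexAnalytic
open Literature.NumberTheory.Transcendental

namespace Literature.AlgebraicGeometry.HodgeTheory

/-- **Changing the sign of the first component preserves submersivity**: if `D(F)(y)` is onto then so is `D(fun y => (−(F y).1, (F y).2))(y)`.
[cite: BrockerJanichIDT1982, §5] -/
theorem surjective_fderiv_neg_fst {E : Type*} [NormedAddCommGroup E] [NormedSpace ℝ E] {F₁ F₂ : Type*}
    [NormedAddCommGroup F₁] [NormedSpace ℝ F₁] [NormedAddCommGroup F₂] [NormedSpace ℝ F₂]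
    {F : E → F₁ × F₂} {y : E} (h : Function.Surjective (fderiv ℝ F y)) :
    Function.Surjective (fderiv ℝ (fun y => (-(F y).1, (F y).2)) y) := by
  haveI : Nontrivial (F₁ × F₂) ∨ Subsingleton (F₁ × F₂) := (subsingleton_or_nontrivial _).symm
  have hd : DifferentiableAt ℝ F y := by
    by_contra hnd
    rw [fderiv_zero_of_not_differentiableAt hnd] at h
    -- `0` onto forces the target to be trivial, in which case every map is onto; handle uniformly below
    rcases subsingleton_or_nontrivial (F₁ × F₂) with hs | hn
    · exact hnd ((differentiableAt_const (F y)).congr_of_eventuallyEq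
        (Filter.Eventually.of_forall fun y' => Subsingleton.elim _ _))
    · obtain ⟨v, hv⟩ := exists_ne (0 : F₁ × F₂)
      obtain ⟨w, hw⟩ := h v
      exact hv (by rw [← hw]; rfl)
  -- the linear automorphism `(c, t) ↦ (−c, t)`
  set Lneg : F₁ × F₂ →L[ℝ] F₁ × F₂ := (-(ContinuousLinearMap.fst ℝ F₁ F₂)).prod (ContinuousLinearMap.snd ℝ F₁ F₂) with hL
  have hcomp : (fun y => (-(F y).1, (F y).2)) = Lneg ∘ F := by
    funext y'; simp [hL]
  rw [hcomp, fderiv_comp y Lneg.differentiableAt hd, Lneg.fderiv, ContinuousLinearMap.coe_comp]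
  refine Function.Surjective.comp (fun v => ⟨(-v.1, v.2), by simp [hL]⟩) h

variable (p : ℕ)

/-- **Joint submersivity of (coefficients, Morse radius) on the Morse shells of the nodal pencil.** Let `p ≥ 3`, `Θ` a `C^∞` open partial
homeomorphism of `ℂ³` with `C^∞` inverse and `Σ (Θ x)ᵢ^{eᵢ} = φ(x) = x₂^p − (x₀x₁ + x₀^p + x₁^p)` on its source, radii `0 < r₀ ≤ r₂ < 1` with
`r₂^{p−2} < 2/p`, `B` a `C^∞` real function of the chart coordinates of `𝒴°(ℂ)₂`. If `Q ∈ 𝒴°(ℂ)₂` has remaining coefficients `b'(Q)` those of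
`x₃^p − f₁`, affine coordinates `y = y(Q) ∈ Θ.source` with `r₀² ≤ Σ|Θ y|² ≤ r₂²` and `|φ(y)| < r₀^p`, and `B` agrees with `v ↦ Σ|Θ(v_y)|²` near
`Φ₂(Q)`, then the differential at `Q` of `Q' ↦ (b(Q'), regChartExtend 2 p 2 B Q')` is onto.
[cite: Milnor1968, Lemma 5.10] [cite: CarlsonToledo1999, §6 (kdoublept)] -/
theorem surjective_mfderiv_regCoeff_prod_morseRadius (hp : 3 ≤ p)
    (Θ : OpenPartialHomeomorph (Fin (1 + 2) → ℂ) (Fin (1 + 2) → ℂ))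
    (hΘ : ContDiffOn ℝ ∞ Θ Θ.source) (hΘs : ContDiffOn ℝ ∞ Θ.symm Θ.target)
    (hΘφ : ∀ x ∈ Θ.source, ∑ i, (Θ x) i ^ PhamBrieskorn.cyclicNodeExponents p i = x 2 ^ p - (x 0 * x 1 + x 0 ^ p + x 1 ^ p))
    {r₀ r₂ : ℝ} (hr₀ : 0 < r₀) (hr₀₂ : r₀ ≤ r₂) (hr₂ : r₂ < 1) (hr₂' : r₂ ^ (p - 2) < 2 / p)
    (B : (ChartIdx 2 p 2 → ℂ) → ℝ) (hB : ContDiff ℝ ∞ B)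
    {Q : ComplexPoints (regularTotal ℂ 2 p)} (hQ : Q ∈ regChartDom 2 p 2)
    (hb' : ∀ m : {m : DegIndex 2 p // m ≠ regPowIndex 2 p 2},
      regChartFun 2 p 2 Q (Sum.inl m) =
        coeffsOf 2 p (cyclicCoverForm p (X 2 ^ (p - 2) * (X 0 * X 1) + X 0 ^ p + X 1 ^ p)) m.1)
    (hy : (fun j => regChartFun 2 p 2 Q (Sum.inr j)) ∈ Θ.source)
    (hlow : r₀ ^ 2 ≤ ∑ i, ‖Θ (fun j => regChartFun 2 p 2 Q (Sum.inr j)) i‖ ^ 2)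
    (hup : ∑ i, ‖Θ (fun j => regChartFun 2 p 2 Q (Sum.inr j)) i‖ ^ 2 ≤ r₂ ^ 2)
    (hφ : ‖(fun x : Fin (1 + 2) → ℂ => x 2 ^ p - (x 0 * x 1 + x 0 ^ p + x 1 ^ p)) (fun j => regChartFun 2 p 2 Q (Sum.inr j))‖ < r₀ ^ p)
    (hBloc : B =ᶠ[𝓝 (regChartFun 2 p 2 Q)] fun v => ∑ i, ‖Θ (fun j => v (Sum.inr j)) i‖ ^ 2) :
    haveI := locallyOfFiniteType_regularTotal_hom ℂ 2 p (by omega)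
    haveI := smoothOfRelativeDimension_regularTotal_hom ℂ 2 p (by omega)
    letI := ComplexPoints.chartedSpace (regularTotal ℂ 2 p) (2 + Fintype.card (DegIndex 2 p))
    Function.Surjective (mfderiv (𝓡 (2 * (2 + Fintype.card (DegIndex 2 p)))) 𝓘(ℝ, (DegIndex 2 p → ℂ) × ℝ)
      (fun Q' => (regCoeff ℂ 2 p Q', regChartExtend 2 p 2 B Q')) Q) := by
  have hd : 0 < p := by omega
  -- chart coordinates of `Q`: `v₀ = (b'₀, y)`
  set y : Fin 3 → ℂ := fun j => regChartFun 2 p 2 Q (Sum.inr j) with hydef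
  set b'₀ : {m : DegIndex 2 p // m ≠ regPowIndex 2 p 2} → ℂ := fun m =>
    coeffsOf 2 p (cyclicCoverForm p (X 2 ^ (p - 2) * (X 0 * X 1) + X 0 ^ p + X 1 ^ p)) m.1 with hb'₀
  have hv₀ : regChartFun 2 p 2 Q = Sum.elim b'₀ y := by
    funext s
    rcases s with m | j
    · exact hb' m
    · rfl
  -- Step 1: manifold ⇐ Euclidean in the chart
  refine surjective_mfderiv_pair_of_surjective_fderiv 2 p 2 hd B hB hQ ?_
  rw [hv₀]
  -- Step 2: Euclidean ⇐ partial map in `y`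
  refine surjective_fderiv_coeffVec_prod_of_partial 2 p 2 B b'₀ y ((hB.differentiable (by simp)).differentiableAt) ?_
  -- Step 3: the partial map is `(−φ, Σ|Θ|²)` near `y`
  have hcont : Continuous fun y' : Fin 3 → ℂ => (Sum.elim b'₀ y' : ChartIdx 2 p 2 → ℂ) := by
    refine continuous_pi fun s => ?_
    rcases s with m | j
    · exact continuous_const
    · exact continuous_apply j
  have hBy : (fun y' : Fin 3 → ℂ => B (Sum.elim b'₀ y')) =ᶠ[𝓝 y]
      fun y' => ∑ i, ‖Θ y' i‖ ^ 2 := by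
    have ht : Tendsto (fun y' : Fin 3 → ℂ => (Sum.elim b'₀ y' : ChartIdx 2 p 2 → ℂ)) (𝓝 y) (𝓝 (regChartFun 2 p 2 Q)) := by
      rw [hv₀]; exact hcont.continuousAt
    filter_upwards [ht.eventually hBloc] with y' hy'
    exact hy'
  have hpartial : (fun y' : Fin 3 → ℂ =>
      (regChartCoeffVec 2 p 2 (Sum.elim b'₀ y') (regPowIndex 2 p 2), B (Sum.elim b'₀ y'))) =ᶠ[𝓝 y]
      fun y' => (-((fun x : Fin (1 + 2) → ℂ => x 2 ^ p - (x 0 * x 1 + x 0 ^ p + x 1 ^ p)) y'), ∑ i, ‖Θ y' i‖ ^ 2) := by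
    filter_upwards [hBy] with y' hy'
    rw [Prod.mk.injEq]
    exact ⟨regChartCoeffVec_nodalPencil_regPowIndex p hp y', hy'⟩
  rw [hpartial.fderiv_eq]
  -- Step 4: `(φ, Σ|Θ|²)` is submersive on the shell, hence so is `(−φ, Σ|Θ|²)`
  have hA := PhamBrieskorn.surjective_fderiv_pencil_morseRadius_of_shell p hp Θ hΘ hΘs
    (fun x => x 2 ^ p - (x 0 * x 1 + x 0 ^ p + x 1 ^ p)) hΘφ hr₀ hr₀₂ hr₂ hr₂' hy hlow hup hφ
  exact surjective_fderiv_neg_fst (F := fun y' : Fin (1 + 2) → ℂ =>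
    (((fun x : Fin (1 + 2) → ℂ => x 2 ^ p - (x 0 * x 1 + x 0 ^ p + x 1 ^ p)) y' : ℂ), (∑ i, ‖Θ y' i‖ ^ 2 : ℝ))) hA

end Literature.AlgebraicGeometry.HodgeTheory

end
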